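import Literature.RepresentationTheory.HeisenbergGroup.SchrodingerDirectSum
import Literature.RepresentationTheory.HeisenbergGroup.HeisenbergCoboundary
import HarnessLib

/-!
# The doubled symplectic space `W ⊕ W⁻` in the polarisation adapted to the DIAGONAL Lagrangian `ℓ_Δ`:
# coordinates `ℓ_∇ ⊕ ℓ_Δ`, the Gram pairing `J_Δ`, and the isomorphism of Heisenberg groups

Topic `RepresentationTheory/HeisenbergGroup`; namespace `Literature.RepresentationTheory.HeisenbergGroup`.  KERNEL ONLY:
definitions with bodies + theorems; no record, no named fact, no `sorry`.

Setting (that of `SchrodingerDirectSum.lean` with EQUAL summand index types): a commutative ring `K` with `⅟2`, index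
types `κ`, `ι` with `e : κ ⊕ κ ≃ ι`, a Gram matrix `T₀ : Matrix κ κ K` and the DOUBLED Gram matrix
`T = reindex e e (T₀ ⊕ (−T₀))` (`hT`; the tree's `gramD`, [Kudla1994, §2; HarrisKudlaSweet1996, §1 (1.9)–(1.11)]).  The
symplectic space of the tree's Schrödinger files is `𝕎 = (ι → K) × (ι → K)` with `polar β_T`, `β_T(x, y) = x ⬝ᵥ T y`.
Besides the tree's polarisation `X ⊕ Y` it carries the polarisation by the two Lagrangians

  `ℓ_Δ = {(a ⊔ a, b ⊔ b)}` (the diagonal, tree `deltaLagrangian`) and `ℓ_∇ = {(a ⊔ −a, b ⊔ −b)}` (the antidiagonal).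

* §1 `toLinearMap₂'_fromBlocks_offDiag` / `_glue_offDiag` — the pairing of an off-diagonal block matrix;
* §2 `nablaW e a b`, `deltaW e a b ∈ 𝕎` and the Gram matrix **`deltaGram e T₀ = reindex e e (0, 2T₀; −2T₀ᵀ, 0)`** of
  the `ℓ_Δ`-ADAPTED pairing `β_Δ : X_Δ × Y_Δ → K`, `X_Δ = Y_Δ = (ι → K)` (`p = a ⊔ b ↔ nablaW a b`,
  `q = α ⊔ β ↔ deltaW α β`): the symplectic form of `𝕎` in these coordinates is `β_Δ(p, q') − β_Δ(p', q)`
  (`polar_nablaW_deltaW`, `polar_deltaW_nablaW`, `deltaPulledCocycle_sub_flip`), both `ℓ`'s are isotropic for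
  `polar β_T` itself (`polar_nablaW_nablaW`, `polar_deltaW_deltaW`);
* §3 the linear change of coordinates `deltaCoords : 𝕎 ≃ₗ (ι → K) × (ι → K)`,
  `(x, y) ↦ (½(x_L − x_R) ⊔ ½(y_L − y_R), ½(x_L + x_R) ⊔ ½(y_L + y_R))`, with inverse
  `(p, q) ↦ nablaW(p_L, p_R) + deltaW(q_L, q_R)`;
* §4 **`deltaHeisenbergEquiv : Heisenberg (polar β_T) ≃* Heisenberg (polar β_Δ)`**, `(w, t) ↦ (deltaCoords w, t + q w)`
  with `q w = ½ (β_Δ((deltaCoords w).1, (deltaCoords w).2) − β_T(w.1, w.2))` — the tree's `Heisenberg.coboundaryEquiv`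
  (the two polarised cocycles have the same alternation, §2) followed by `Heisenberg.congrEquiv`; it is the identity on
  the centre and sends `(nablaW a b, t) ↦ ((a ⊔ b, 0), t)`, `(deltaW α β, t) ↦ ((0, α ⊔ β), t)`
  (`deltaHeisenbergEquiv_nablaW`, `deltaHeisenbergEquiv_deltaW`): the elements of `ℓ_∇` become TRANSLATIONS and those of
  `ℓ_Δ` MODULATIONS of the Schrödinger model `schrodinger β_Δ ψ` on functions on `X_Δ`.

This is the «changement de polarisation» bookkeeping of [MoeglinVignerasWaldspurger1987, Chap. 2 I.7, II.6] for the
doubled space, written in the coordinates of the tree.  Consumers: the Frobenius intertwiner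
`frobeniusToSchrodinger (ρ_T ∘ deltaHeisenbergEquiv⁻¹) Λ` (`SchrodingerFrobenius.lean`) from the doubled Schrödinger
model `𝒮(K^κ) ⊗ 𝒮(K^κ)` to the `ℓ_Δ`-model — node E2 of the doubling proof of
`MoeglinVignerasWaldspurger1987.mvw_IV4_rankOne_irreducibleOrZero` (cell `hodgecm-mathlib`, KEY `b4-howe-compact-irreducible`).
Nothing about theta lifts is asserted here.

## References
* [MoeglinVignerasWaldspurger1987] C. Mœglin, M.-F. Vignéras, J.-L. Waldspurger, LNM 1291 (1987), Chap. 2 I.7, II.6.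
* [Kudla1994] S. Kudla, Israel J. Math. 87 (1994), §2–§3 (the doubled space and the diagonal Lagrangian).
* [HarrisKudlaSweet1996] M. Harris, S. Kudla, W. Sweet, J. AMS 9 (1996), §1 (1.9)–(1.11).
-/

set_option autoImplicit false

noncomputable section

namespace Literature.RepresentationTheory.HeisenbergGroup

open Literature.NumberTheory.Automorphic

/-! ## §1 Off-diagonal block pairings -/

section OffDiag

variable {K : Type*} [CommRing K] {ι₁ ι₂ ι : Type*} [Fintype ι₁] [Fintype ι₂] [Fintype ι]
  [DecidableEq ι₁] [DecidableEq ι₂] [DecidableEq ι] (e : ι₁ ⊕ ι₂ ≃ ι)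

/-- the pairing of the off-diagonal block matrix `(0, B; C, 0)`. [cite: Kudla1994, §2] -/
theorem toLinearMap₂'_fromBlocks_offDiag (B : Matrix ι₁ ι₂ K) (C : Matrix ι₂ ι₁ K) (x y : ι₁ ⊕ ι₂ → K) :
    Matrix.toLinearMap₂' K (Matrix.fromBlocks 0 B C 0) x y =
      Matrix.toLinearMap₂' K B (x ∘ Sum.inl) (y ∘ Sum.inr) + Matrix.toLinearMap₂' K C (x ∘ Sum.inr) (y ∘ Sum.inl) := by
  rw [Matrix.toLinearMap₂'_apply', Matrix.toLinearMap₂'_apply', Matrix.toLinearMap₂'_apply']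
  conv_lhs => rw [← Sum.elim_comp_inl_inr x]
  rw [Matrix.fromBlocks_mulVec, Matrix.zero_mulVec, Matrix.zero_mulVec, add_zero, zero_add, sumElim_dotProduct_sumElim]

/-- the same through the enumeration `e`, on glued vectors. [cite: Kudla1994, §2] -/
theorem toLinearMap₂'_glue_offDiag (B : Matrix ι₁ ι₂ K) (C : Matrix ι₂ ι₁ K) (a b : ι₁ → K) (a' b' : ι₂ → K) :
    Matrix.toLinearMap₂' K (Matrix.reindex e e (Matrix.fromBlocks 0 B C 0)) (glue e a a') (glue e b b') =
      Matrix.toLinearMap₂' K B a b' + Matrix.toLinearMap₂' K C a' b := by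
  have ha : glue e a a' = Sum.elim a a' ∘ e.symm := rfl
  have hb : glue e b b' = Sum.elim b b' ∘ e.symm := rfl
  rw [ha, hb, UnitaryGroup.toLinearMap₂'_reindex, toLinearMap₂'_fromBlocks_offDiag]
  rfl

end OffDiag

/-! ## §2 The two Lagrangians `ℓ_∇`, `ℓ_Δ` and the `ℓ_Δ`-adapted Gram matrix -/

section Delta

variable {K : Type*} [CommRing K] {κ ι : Type*} [Fintype κ] [Fintype ι] [DecidableEq κ] [DecidableEq ι]
  (e : κ ⊕ κ ≃ ι) (T₀ : Matrix κ κ K) {T : Matrix ι ι K}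
  (hT : T = Matrix.reindex e e (Matrix.fromBlocks T₀ 0 0 (-T₀)))

/-- the antidiagonal vector `(a ⊔ −a, b ⊔ −b) ∈ ℓ_∇`. [cite: Kudla1994, §2] -/
def nablaW (a b : κ → K) : (ι → K) × (ι → K) := (glue e a (-a), glue e b (-b))

/-- the diagonal vector `(a ⊔ a, b ⊔ b) ∈ ℓ_Δ`. [cite: Kudla1994, §2] -/
def deltaW (a b : κ → K) : (ι → K) × (ι → K) := (glue e a a, glue e b b)

omit [Fintype κ] [Fintype ι] [DecidableEq κ] [DecidableEq ι] in
/-- components. [cite: Kudla1994, §2] -/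
@[simp] theorem nablaW_fst (a b : κ → K) : (nablaW e a b).1 = glue e a (-a) := rfl
omit [Fintype κ] [Fintype ι] [DecidableEq κ] [DecidableEq ι] in
/-- components. [cite: Kudla1994, §2] -/
@[simp] theorem nablaW_snd (a b : κ → K) : (nablaW e a b).2 = glue e b (-b) := rfl
omit [CommRing K] [Fintype κ] [Fintype ι] [DecidableEq κ] [DecidableEq ι] in
/-- components. [cite: Kudla1994, §2] -/
@[simp] theorem deltaW_fst (a b : κ → K) : (deltaW e a b).1 = glue e a a := rfl
omit [CommRing K] [Fintype κ] [Fintype ι] [DecidableEq κ] [DecidableEq ι] in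
/-- components. [cite: Kudla1994, §2] -/
@[simp] theorem deltaW_snd (a b : κ → K) : (deltaW e a b).2 = glue e b b := rfl

/-- **the `ℓ_Δ`-adapted Gram matrix** `J_Δ = (0, 2T₀; −2T₀ᵀ, 0)` read through `e`: the pairing
`β_Δ(a ⊔ b, α ⊔ β) = 2(a ⬝ᵥ T₀ β − α ⬝ᵥ T₀ b)` between `X_Δ ≅ ℓ_∇` and `Y_Δ ≅ ℓ_Δ`. [cite: Kudla1994, §2] -/
def deltaGram : Matrix ι ι K := Matrix.reindex e e (Matrix.fromBlocks 0 ((2 : K) • T₀) (-((2 : K) • T₀.transpose)) 0)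

/-- **the adapted pairing on glued coordinates**: `β_Δ(a ⊔ b, α ⊔ β) = 2 (a ⬝ᵥ T₀ β) − 2 (α ⬝ᵥ T₀ b)`.
[cite: Kudla1994, §2] -/
theorem deltaGram_glue (a b α β : κ → K) :
    Matrix.toLinearMap₂' K (deltaGram e T₀) (glue e a b) (glue e α β) =
      2 * Matrix.toLinearMap₂' K T₀ a β - 2 * Matrix.toLinearMap₂' K T₀ α b := by
  rw [deltaGram, toLinearMap₂'_glue_offDiag]
  simp only [Matrix.toLinearMap₂'_apply']
  rw [Matrix.neg_mulVec, dotProduct_neg, Matrix.smul_mulVec, Matrix.smul_mulVec, dotProduct_smul, dotProduct_smul,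
    Matrix.mulVec_transpose, dotProduct_comm b, ← Matrix.dotProduct_mulVec, smul_eq_mul, smul_eq_mul]
  ring

include hT in
/-- `β_T` on an antidiagonal and a diagonal vector: `β_T((a ⊔ −a), (β ⊔ β)) = 2 a ⬝ᵥ T₀ β`.
[cite: Kudla1994, §2] -/
theorem toLinearMap₂'_nabla_delta (a β : κ → K) :
    Matrix.toLinearMap₂' K T (glue e a (-a)) (glue e β β) = 2 * Matrix.toLinearMap₂' K T₀ a β := by
  rw [toLinearMap₂'_glue e T₀ (-T₀) hT]
  simp only [Matrix.toLinearMap₂'_apply', Matrix.neg_mulVec, dotProduct_neg, neg_dotProduct, neg_neg]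
  ring

include hT in
/-- `β_T` on a diagonal and an antidiagonal vector: `β_T((α ⊔ α), (b ⊔ −b)) = 2 α ⬝ᵥ T₀ b`. [cite: Kudla1994, §2] -/
theorem toLinearMap₂'_delta_nabla (α b : κ → K) :
    Matrix.toLinearMap₂' K T (glue e α α) (glue e b (-b)) = 2 * Matrix.toLinearMap₂' K T₀ α b := by
  rw [toLinearMap₂'_glue e T₀ (-T₀) hT]
  simp only [Matrix.toLinearMap₂'_apply', Matrix.neg_mulVec, Matrix.mulVec_neg, neg_neg]
  ring

include hT in
/-- `β_T` on two antidiagonal vectors vanishes: `β_T((a ⊔ −a), (b ⊔ −b)) = 0`. [cite: Kudla1994, §2] -/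
theorem toLinearMap₂'_nabla_nabla (a b : κ → K) :
    Matrix.toLinearMap₂' K T (glue e a (-a)) (glue e b (-b)) = 0 := by
  rw [toLinearMap₂'_glue e T₀ (-T₀) hT]
  simp only [Matrix.toLinearMap₂'_apply', Matrix.neg_mulVec, Matrix.mulVec_neg, neg_dotProduct, neg_neg,
    add_neg_cancel]

include hT in
/-- `β_T` on two diagonal vectors vanishes: `β_T((α ⊔ α), (β ⊔ β)) = 0`. [cite: Kudla1994, §2] -/
theorem toLinearMap₂'_delta_delta (α β : κ → K) :
    Matrix.toLinearMap₂' K T (glue e α α) (glue e β β) = 0 := by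
  rw [toLinearMap₂'_glue e T₀ (-T₀) hT]
  simp only [Matrix.toLinearMap₂'_apply', Matrix.neg_mulVec, dotProduct_neg, add_neg_cancel]

include hT in
/-- **the polarised cocycle vanishes on `ℓ_∇ × ℓ_∇`**. [cite: Kudla1994, §2] -/
theorem polar_nablaW_nablaW (a b a' b' : κ → K) :
    polar (Matrix.toLinearMap₂' K T) (nablaW e a b) (nablaW e a' b') = 0 := by
  rw [polar_apply, nablaW_fst, nablaW_snd, toLinearMap₂'_nabla_nabla e T₀ hT]

include hT in
/-- **the polarised cocycle vanishes on `ℓ_Δ × ℓ_Δ`**. [cite: Kudla1994, §2] -/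
theorem polar_deltaW_deltaW (a b a' b' : κ → K) :
    polar (Matrix.toLinearMap₂' K T) (deltaW e a b) (deltaW e a' b') = 0 := by
  rw [polar_apply, deltaW_fst, deltaW_snd, toLinearMap₂'_delta_delta e T₀ hT]

include hT in
/-- `polar β_T(nablaW a b, deltaW α β) = 2 a ⬝ᵥ T₀ β`. [cite: Kudla1994, §2] -/
theorem polar_nablaW_deltaW (a b α β : κ → K) :
    polar (Matrix.toLinearMap₂' K T) (nablaW e a b) (deltaW e α β) = 2 * Matrix.toLinearMap₂' K T₀ a β := by
  rw [polar_apply, nablaW_fst, deltaW_snd, toLinearMap₂'_nabla_delta e T₀ hT]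

include hT in
/-- `polar β_T(deltaW α β, nablaW a b) = 2 α ⬝ᵥ T₀ b`. [cite: Kudla1994, §2] -/
theorem polar_deltaW_nablaW (a b α β : κ → K) :
    polar (Matrix.toLinearMap₂' K T) (deltaW e α β) (nablaW e a b) = 2 * Matrix.toLinearMap₂' K T₀ α b := by
  rw [polar_apply, deltaW_fst, nablaW_snd, toLinearMap₂'_delta_nabla e T₀ hT]

/-! ## §3 The change of coordinates `𝕎 ≃ X_Δ × Y_Δ` -/

variable [Invertible (2 : K)]

omit [Fintype κ] [Fintype ι] [DecidableEq κ] [DecidableEq ι] [Invertible (2 : K)] in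
/-- glue commutes with subtraction. [cite: Kudla1984, §1] -/
theorem glue_sub (a a' b b' : κ → K) : glue e a b - glue e a' b' = glue e (a - a') (b - b') := by
  funext k
  obtain ⟨s, rfl⟩ := e.surjective k
  rcases s with i | j <;> simp [glue]

omit [Fintype κ] [Fintype ι] [DecidableEq κ] [DecidableEq ι] [Invertible (2 : K)] in
/-- glue commutes with scalars. [cite: Kudla1984, §1] -/
theorem smul_glue (c : K) (a b : κ → K) : c • glue e a b = glue e (c • a) (c • b) := by
  funext k
  obtain ⟨s, rfl⟩ := e.surjective k
  rcases s with i | j <;> simp [glue]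

omit [Fintype κ] [Fintype ι] [DecidableEq κ] [DecidableEq ι] in
/-- `½(u − v) + ½(u + v) = u`. [folklore] -/
private theorem half_smul_sub_add_half_smul_add (u v : κ → K) : ⅟(2 : K) • (u - v) + ⅟(2 : K) • (u + v) = u := by
  funext i
  simp only [Pi.add_apply, Pi.smul_apply, Pi.sub_apply, smul_eq_mul]
  linear_combination (u i) * invOf_mul_self (2 : K)

omit [Fintype κ] [Fintype ι] [DecidableEq κ] [DecidableEq ι] in
/-- `−½(u − v) + ½(u + v) = v`. [folklore] -/
private theorem neg_half_smul_sub_add_half_smul_add (u v : κ → K) : -(⅟(2 : K) • (u - v)) + ⅟(2 : K) • (u + v) = v := by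
  funext i
  simp only [Pi.add_apply, Pi.neg_apply, Pi.smul_apply, Pi.sub_apply, smul_eq_mul]
  linear_combination (v i) * invOf_mul_self (2 : K)

omit [Fintype κ] [Fintype ι] [DecidableEq κ] [DecidableEq ι] in
/-- `½(a − (−a)) = a`. [folklore] -/
private theorem half_smul_sub_neg (a : κ → K) : ⅟(2 : K) • (a - -a) = a := by
  funext i
  simp only [Pi.smul_apply, Pi.sub_apply, Pi.neg_apply, smul_eq_mul]
  linear_combination (a i) * invOf_mul_self (2 : K)

omit [Fintype κ] [Fintype ι] [DecidableEq κ] [DecidableEq ι] in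
/-- `½(a + a) = a`. [folklore] -/
private theorem half_smul_add_self (a : κ → K) : ⅟(2 : K) • (a + a) = a := by
  funext i
  simp only [Pi.smul_apply, Pi.add_apply, smul_eq_mul]
  linear_combination (a i) * invOf_mul_self (2 : K)

omit [Fintype κ] [Fintype ι] [DecidableEq κ] [DecidableEq ι] in
/-- `½((a + α) − (−a + α)) = a`. [folklore] -/
private theorem half_smul_sum_sub (a α : κ → K) : ⅟(2 : K) • ((a + α) - (-a + α)) = a := by
  funext i
  simp only [Pi.smul_apply, Pi.add_apply, Pi.sub_apply, Pi.neg_apply, smul_eq_mul]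
  linear_combination (a i) * invOf_mul_self (2 : K)

omit [Fintype κ] [Fintype ι] [DecidableEq κ] [DecidableEq ι] in
/-- `½((a + α) + (−a + α)) = α`. [folklore] -/
private theorem half_smul_sum_add (a α : κ → K) : ⅟(2 : K) • ((a + α) + (-a + α)) = α := by
  funext i
  simp only [Pi.smul_apply, Pi.add_apply, Pi.neg_apply, smul_eq_mul]
  linear_combination (α i) * invOf_mul_self (2 : K)

omit [Fintype κ] [Fintype ι] [DecidableEq κ] [DecidableEq ι] [Invertible (2 : K)] in
/-- glue commutes with negation. [cite: Kudla1984, §1] -/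
theorem neg_glue (a b : κ → K) : -glue e a b = glue e (-a) (-b) := by
  funext k
  obtain ⟨s, rfl⟩ := e.surjective k
  rcases s with i | j <;> simp [glue]

omit [Fintype κ] [Fintype ι] [DecidableEq κ] [DecidableEq ι] [Invertible (2 : K)] in
/-- `nablaW a b + deltaW α β = ((a + α) ⊔ (−a + α), (b + β) ⊔ (−b + β))`. [cite: Kudla1994, §2] -/
theorem nablaW_add_deltaW (a b α β : κ → K) :
    nablaW e a b + deltaW e α β = (glue e (a + α) (-a + α), glue e (b + β) (-b + β)) :=
  Prod.ext (glue_add e _ _ _ _) (glue_add e _ _ _ _)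

omit [Fintype κ] [Fintype ι] [DecidableEq κ] [DecidableEq ι] in
/-- **every `w ∈ 𝕎` is `nablaW(½(x_L−x_R), ½(y_L−y_R)) + deltaW(½(x_L+x_R), ½(y_L+y_R))`**. [cite: Kudla1994, §2] -/
theorem nablaW_add_deltaW_eq (w : (ι → K) × (ι → K)) :
    nablaW e (⅟(2 : K) • (resL e w.1 - resR e w.1)) (⅟(2 : K) • (resL e w.2 - resR e w.2)) +
      deltaW e (⅟(2 : K) • (resL e w.1 + resR e w.1)) (⅟(2 : K) • (resL e w.2 + resR e w.2)) = w := by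
  rw [nablaW_add_deltaW, half_smul_sub_add_half_smul_add, neg_half_smul_sub_add_half_smul_add,
    half_smul_sub_add_half_smul_add, neg_half_smul_sub_add_half_smul_add, glue_resL_resR, glue_resL_resR]

/-- **the `ℓ_Δ`-adapted coordinates** `(x, y) ↦ (p, q) = (½(x_L−x_R) ⊔ ½(y_L−y_R), ½(x_L+x_R) ⊔ ½(y_L+y_R))`, a
linear equivalence `𝕎 ≃ X_Δ × Y_Δ` with inverse `(p, q) ↦ nablaW(p_L, p_R) + deltaW(q_L, q_R)`. [cite: Kudla1994, §2] -/
def deltaCoords : ((ι → K) × (ι → K)) ≃ₗ[K] ((ι → K) × (ι → K)) where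
  toFun w := (glue e (⅟(2 : K) • (resL e w.1 - resR e w.1)) (⅟(2 : K) • (resL e w.2 - resR e w.2)),
    glue e (⅟(2 : K) • (resL e w.1 + resR e w.1)) (⅟(2 : K) • (resL e w.2 + resR e w.2)))
  invFun u := nablaW e (resL e u.1) (resR e u.1) + deltaW e (resL e u.2) (resR e u.2)
  map_add' w w' := by
    refine Prod.ext ?_ ?_ <;>
    · show glue e _ _ = glue e _ _ + glue e _ _
      rw [glue_add]
      congr 1 <;> funext i <;>
        simp only [Prod.fst_add, Prod.snd_add, resL_add, resR_add, Pi.add_apply, Pi.smul_apply, Pi.sub_apply,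
          smul_eq_mul] <;> ring
  map_smul' c w := by
    refine Prod.ext ?_ ?_ <;>
    · show glue e _ _ = c • glue e _ _
      rw [smul_glue]
      congr 1 <;> funext i <;>
        simp only [Prod.smul_fst, Prod.smul_snd, Pi.smul_apply, Pi.sub_apply, Pi.add_apply, smul_eq_mul, resL, resR] <;>
        ring
  left_inv w := by
    show nablaW e _ _ + deltaW e _ _ = w
    simp only [resL_glue, resR_glue]
    exact nablaW_add_deltaW_eq e w
  right_inv u := by
    obtain ⟨p, q⟩ := u
    show (glue e _ _, glue e _ _) = (p, q)
    simp only [nablaW_add_deltaW, resL_glue, resR_glue, half_smul_sum_sub, half_smul_sum_add, glue_resL_resR]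

omit [Fintype κ] [Fintype ι] [DecidableEq κ] [DecidableEq ι] in
/-- `deltaCoords (nablaW a b) = (a ⊔ b, 0)`. [cite: Kudla1994, §2] -/
@[simp] theorem deltaCoords_nablaW (a b : κ → K) : deltaCoords e (nablaW e a b) = (glue e a b, 0) := by
  show (glue e _ _, glue e _ _) = (glue e a b, 0)
  simp only [nablaW_fst, nablaW_snd, resL_glue, resR_glue, half_smul_sub_neg, add_neg_cancel, smul_zero, glue_zero]

omit [Fintype κ] [Fintype ι] [DecidableEq κ] [DecidableEq ι] in
/-- `deltaCoords (deltaW α β) = (0, α ⊔ β)`. [cite: Kudla1994, §2] -/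
@[simp] theorem deltaCoords_deltaW (α β : κ → K) : deltaCoords e (deltaW e α β) = (0, glue e α β) := by
  show (glue e _ _, glue e _ _) = (0, glue e α β)
  simp only [deltaW_fst, deltaW_snd, resL_glue, resR_glue, sub_self, smul_zero, glue_zero, half_smul_add_self]

/-! ## §4 The isomorphism of Heisenberg groups -/

/-- the pulled-back cocycle `B₁(w, w') = β_Δ((deltaCoords w).1, (deltaCoords w').2)`. [cite: MoeglinVignerasWaldspurger1987, Chap. 2 I.7] -/
abbrev deltaPulledCocycle : ((ι → K) × (ι → K)) →ₗ[K] ((ι → K) × (ι → K)) →ₗ[K] K :=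
  (polar (Matrix.toLinearMap₂' K (deltaGram e T₀))).compl₁₂ (deltaCoords (K := K) e : ((ι → K) × (ι → K)) →ₗ[K] ((ι → K) × (ι → K)))
    (deltaCoords (K := K) e : ((ι → K) × (ι → K)) →ₗ[K] ((ι → K) × (ι → K)))

omit [Fintype κ] [DecidableEq κ] in
/-- formula. [cite: MoeglinVignerasWaldspurger1987, Chap. 2 I.7] -/
theorem deltaPulledCocycle_apply (w w' : (ι → K) × (ι → K)) :
    deltaPulledCocycle e T₀ w w' =
      Matrix.toLinearMap₂' K (deltaGram e T₀) (deltaCoords e w).1 (deltaCoords e w').2 := rfl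

/-- the correcting «caractère du second degré» `q(w) = ½ (B₁(w, w) − β_T(w.1, w.2))`.
[cite: MoeglinVignerasWaldspurger1987, Chap. 2 I.7] -/
def deltaCorrection (w : (ι → K) × (ι → K)) : K :=
  ⅟(2 : K) * (deltaPulledCocycle e T₀ w w - polar (Matrix.toLinearMap₂' K T) w w)

include hT in
/-- **the two cocycles have the same alternation**: `B₁(w, w') − B₁(w', w) = β_T(w, w') − β_T(w', w)` (the symplectic
form of `𝕎` in the two polarisations). [cite: MoeglinVignerasWaldspurger1987, Chap. 2 I.7] -/
theorem deltaPulledCocycle_sub_flip (w w' : (ι → K) × (ι → K)) :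
    deltaPulledCocycle e T₀ w w' - deltaPulledCocycle e T₀ w' w =
      polar (Matrix.toLinearMap₂' K T) w w' - polar (Matrix.toLinearMap₂' K T) w' w := by
  -- write both vectors in the `∇/Δ` decomposition and expand bilinearly
  obtain ⟨a, b, α, β, rfl⟩ : ∃ a b α β : κ → K, w = nablaW e a b + deltaW e α β :=
    ⟨_, _, _, _, (nablaW_add_deltaW_eq e w).symm⟩
  obtain ⟨a', b', α', β', rfl⟩ : ∃ a' b' α' β' : κ → K, w' = nablaW e a' b' + deltaW e α' β' :=
    ⟨_, _, _, _, (nablaW_add_deltaW_eq e w').symm⟩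
  simp only [deltaPulledCocycle_apply, map_add, LinearMap.add_apply, deltaCoords_nablaW,
    deltaCoords_deltaW, add_zero, zero_add, map_zero, LinearMap.zero_apply, deltaGram_glue, polar_nablaW_nablaW e T₀ hT,
    polar_deltaW_deltaW e T₀ hT, polar_nablaW_deltaW e T₀ hT, polar_deltaW_nablaW e T₀ hT]
  ring

include hT in
/-- **the coboundary relation** `B₁(w, w') = β_T(w, w') + (q(w + w') − q(w) − q(w'))`.
[cite: MoeglinVignerasWaldspurger1987, Chap. 2 I.7] -/
theorem deltaPulledCocycle_eq_add_coboundary (w w' : (ι → K) × (ι → K)) :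
    deltaPulledCocycle e T₀ w w' =
      polar (Matrix.toLinearMap₂' K T) w w' + (deltaCorrection e T₀ (T := T) (w + w') - deltaCorrection e T₀ (T := T) w -
        deltaCorrection e T₀ (T := T) w') := by
  have halt := deltaPulledCocycle_sub_flip e T₀ hT w w'
  have h2 : ⅟(2 : K) * 2 = 1 := invOf_mul_self _
  simp only [deltaCorrection, map_add, LinearMap.add_apply]
  linear_combination (⅟(2 : K)) * halt +
    (polar (Matrix.toLinearMap₂' K T) w w' - deltaPulledCocycle e T₀ w w') * h2

include hT in
/-- **`Heisenberg (polar β_T) ≃* Heisenberg (polar β_Δ)`**, `(w, t) ↦ (deltaCoords w, t + q w)` — change of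
polarisation of the doubled space. [cite: MoeglinVignerasWaldspurger1987, Chap. 2 I.7] -/
def deltaHeisenbergEquiv :
    Heisenberg (polar (Matrix.toLinearMap₂' K T)) ≃* Heisenberg (polar (Matrix.toLinearMap₂' K (deltaGram e T₀))) :=
  MulEquiv.trans
    (Heisenberg.coboundaryEquiv (polar (Matrix.toLinearMap₂' K T)) (deltaPulledCocycle e T₀) (deltaCorrection e T₀ (T := T))
      (deltaPulledCocycle_eq_add_coboundary e T₀ hT) :
        Heisenberg (polar (Matrix.toLinearMap₂' K T)) ≃* Heisenberg (deltaPulledCocycle e T₀))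
    (Heisenberg.congrEquiv (deltaCoords (K := K) e) (polar (Matrix.toLinearMap₂' K (deltaGram e T₀))) :
        Heisenberg (deltaPulledCocycle e T₀) ≃* Heisenberg (polar (Matrix.toLinearMap₂' K (deltaGram e T₀))))

/-- the `V`-component is `deltaCoords`. [cite: MoeglinVignerasWaldspurger1987, Chap. 2 I.7] -/
@[simp] theorem deltaHeisenbergEquiv_v (h : Heisenberg (polar (Matrix.toLinearMap₂' K T))) :
    (deltaHeisenbergEquiv e T₀ hT h).v = deltaCoords e h.v := rfl

/-- the central component is `t + q(w)`. [cite: MoeglinVignerasWaldspurger1987, Chap. 2 I.7] -/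
@[simp] theorem deltaHeisenbergEquiv_t (h : Heisenberg (polar (Matrix.toLinearMap₂' K T))) :
    (deltaHeisenbergEquiv e T₀ hT h).t = h.t + deltaCorrection e T₀ (T := T) h.v := rfl

include hT in
/-- the correction vanishes on `ℓ_∇`. [cite: MoeglinVignerasWaldspurger1987, Chap. 2 I.7] -/
theorem deltaCorrection_nablaW (a b : κ → K) : deltaCorrection e T₀ (T := T) (nablaW e a b) = 0 := by
  rw [deltaCorrection, deltaPulledCocycle_apply, deltaCoords_nablaW, polar_apply]
  simp only [map_zero, nablaW_fst, nablaW_snd, toLinearMap₂'_nabla_nabla e T₀ hT, sub_self, mul_zero]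

include hT in
/-- the correction vanishes on `ℓ_Δ`. [cite: MoeglinVignerasWaldspurger1987, Chap. 2 I.7] -/
theorem deltaCorrection_deltaW (α β : κ → K) : deltaCorrection e T₀ (T := T) (deltaW e α β) = 0 := by
  rw [deltaCorrection, deltaPulledCocycle_apply, deltaCoords_deltaW, polar_apply]
  simp only [LinearMap.zero_apply, map_zero, deltaW_fst, deltaW_snd, toLinearMap₂'_delta_delta e T₀ hT, sub_self,
    mul_zero]

/-- **`ℓ_∇` becomes the translation Lagrangian**: `(nablaW a b, t) ↦ ((a ⊔ b, 0), t)`.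
[cite: MoeglinVignerasWaldspurger1987, Chap. 2 I.7] -/
theorem deltaHeisenbergEquiv_nablaW (a b : κ → K) (t : K) :
    deltaHeisenbergEquiv e T₀ hT ⟨nablaW e a b, t⟩ = ⟨(glue e a b, 0), t⟩ := by
  apply Heisenberg.ext
  · exact deltaCoords_nablaW e a b
  · show t + deltaCorrection e T₀ (T := T) (nablaW e a b) = t
    rw [deltaCorrection_nablaW e T₀ hT, add_zero]

/-- **`ℓ_Δ` becomes the modulation Lagrangian**: `(deltaW α β, t) ↦ ((0, α ⊔ β), t)`.
[cite: MoeglinVignerasWaldspurger1987, Chap. 2 I.7] -/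
theorem deltaHeisenbergEquiv_deltaW (α β : κ → K) (t : K) :
    deltaHeisenbergEquiv e T₀ hT ⟨deltaW e α β, t⟩ = ⟨(0, glue e α β), t⟩ := by
  apply Heisenberg.ext
  · exact deltaCoords_deltaW e α β
  · show t + deltaCorrection e T₀ (T := T) (deltaW e α β) = t
    rw [deltaCorrection_deltaW e T₀ hT, add_zero]

/-- `deltaHeisenbergEquiv` is the identity on the centre. [cite: MoeglinVignerasWaldspurger1987, Chap. 2 I.7] -/
theorem deltaHeisenbergEquiv_center (t : K) :
    deltaHeisenbergEquiv e T₀ hT ⟨0, t⟩ = ⟨0, t⟩ := by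
  have h0 : (0 : (ι → K) × (ι → K)) = deltaW e 0 0 := by
    refine Prod.ext ?_ ?_ <;> simp [deltaW]
  have h1 : ((0 : ι → K), glue e (0 : κ → K) 0) = (0 : (ι → K) × (ι → K)) := by
    rw [glue_zero]; rfl
  rw [show (⟨0, t⟩ : Heisenberg (polar (Matrix.toLinearMap₂' K T))) = ⟨deltaW e 0 0, t⟩ by rw [← h0],
    deltaHeisenbergEquiv_deltaW, h1]

end Delta

end Literature.RepresentationTheory.HeisenbergGroup

end
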